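import Summits.BirchSwinnertonDyer.Rank1Residual.Additive.RamifiedSevenGenusKatoExpDatumOfLaws
import Literature.NumberTheory.EllipticCurves.DeuringGrossencharacterIdealValuesIntegral
import HarnessLib

set_option autoImplicit false

/-!
# `𝒞₇` genus road (crux `EllipticUnitValueSevenOfGZK`, K7r), row K2C-9 (C6a) file (F-D2): the (psiK) ARGUMENT of
# `KatoExpDatum.ofLaws` DISCHARGED for a pinned frame whose `ψ` carries Deuring generators — `ofLawsOfGenerators`

Cell bsd-cm, seat bsd-cm-prr-ty1 g35 (literature-prover), row K2C-9 (C6a) (pen D1026 (4): «(psiK) is a THEOREM for the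
Deuring `ψ` with clause (vi); discharge it for that `ψ` as a follow-on file after F-C»).  Parts of the row: (F-B)
`Literature/…/ZpExtensionArtinExponent` (art′), (F-A1/F-A2) `RamifiedSevenGenusKatoExpReading{,Values}` (`valOf`, (e1′), (e1),
(eV), (e2) ⇐ `ExpStarCMShape`), (F-C) `RamifiedSevenGenusKatoExpDatumOfLaws` (`KatoExpDatum.ofLaws` from {(e2), (eZ), (psiK)}),
(F-D1) `Literature/…/DeuringGrossencharacterIdealValuesIntegral` (`2ψ(𝔟) ∈ ℤ + ℤ·τ(√−7)` for a `ψ` with Deuring generators).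

## What this file does

For a pinned frame `Φ` (`Module.finrank ℚ Φ.Kcm = 2`, `Φ.sqrtNegSeven² = −7`, `Φ.ιC : K̄cm → ℂ`, `Φ.ψ`, `Φ.𝔣`) and the two
sentences the frame CONSTRUCTOR (K2C-11) has in hand for the Deuring Grössencharacter of a `𝒞₇` member —
* (vi) `hvi : ∃ σ : Φ.Kcm →+* ℂ, ∀ w, Φ.ψ.IsUnramifiedAt w → ∃ α : 𝓞 Φ.Kcm, Ideal.span {α} = w.asIdeal ∧
  Φ.ψ.valueAtUniformizer w = σ α` — VERBATIM clause (vi) of the tree THEOREM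
  `Deuring_exists_heckeCharacter_of_maximalCM_withGenerators_holds` (Silverman II Prop. 10.4: `ψ(𝔓) = α ∈ R_K`);
* (ram) `hram : ∀ w, ¬ Φ.ψ.IsUnramifiedAt w → katoModulus6 7 Φ.𝔣 ≤ w.asIdeal` — the ramification of `ψ` is supported on
  `(42)·𝔣` (from clause (iii) «`ψ` unramified ⇔ good reduction» and `𝔣 = 𝔭₇·(d)`; Kato Prop. 15.9: "cond(ψ) divides (f)") —
§1 proves the (psiK) ARG letter of `KatoExpDatum.ofLaws`: `∃ b₀ b₁ : Ideal (𝓞 Φ.Kcm) → ℤ, ∀ 𝔟, IsTwist 7 Φ.𝔣 𝔟 →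
2 * CM.heckeCharIdealValue Φ.ψ 𝔟 = b₀ 𝔟 + b₁ 𝔟 * Φ.ιC (algebraMap Φ.Kcm K̄cm Φ.sqrtNegSeven)`
(`PinnedKatoGenusFrame.exists_psiCoords_of_generators`, from F-D1 with `τ := Φ.ιC ∘ algebraMap`, `σ(√−7) = ±τ(√−7)`), and
§2 gives the constructor ★ `KatoExpDatum.ofLawsOfGenerators` = `ofLaws` with (psiK) REPLACED by {(vi), (ram)} (the integer
coordinates chosen by `Classical.choose`), its `rfl` projections, and `katoExpCompatShape_of_laws_of_generators`.
NET for the inhabitation ledger of `KatoExpDatum hγ Φ` (p800949): for a frame built on the Deuring character,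
`∃ D : KatoExpDatum hγ Φ` REDUCES to {(e2) `ExpStarCMShape`, (eZ) ★-value law} — the two road-D / crux-content rows.

HONEST LABEL: a wrapper (one `def` with body by `Classical.choose`, kernel lemmas); (vi) and (ram) are hypotheses HERE (their
discharge for a concrete member is the frame constructor's, from the tree's Deuring theorem); (e2)/(eZ) NOT proved; no stub
closes; stmt-BirchSwinnertonDyer-19945 OPEN (4 sorries, zp v17); K2ᶜ-inhabitation NOT done; `X12.CMRamifiedSeven` NOT proved;
no summit statement is proved by this seat; BSD is claimed for no curve.

References: [SilvermanATAEC1994] Ch. II Prop. 10.4 (proof, p. 170), Cor. 10.4.1 (a) (p. 171), Thm. 10.5 (b); [Cox2013] §5.B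
(5.13); [Kato2004Asterisque] §15.6 (p. 254), §15.7 (pp. 255–256), Prop. 15.9 (p. 258), 15.14 (p. 264), (15.16.1) (p. 265),
Thm. 12.5 (1) (p. 221); tree F-C, F-D1, p800949.
-/

noncomputable section

open scoped NumberField TensorProduct
open Field IsDedekindDomain NumberField
open Literature.NumberTheory.GaloisRepresentations
open Literature.NumberTheory.EllipticCurves
open Literature.NumberTheory.EllipticCurves.Rank1Residual
open Literature.NumberTheory.EllipticCurves.IwasawaAlgebra
open Literature.NumberTheory.EllipticCurves.Kato2004
open Literature.NumberTheory.ComplexMultiplication.EllipticUnits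
open Literature.NumberTheory.EllipticCurves.DeuringIdealValues
open Summit.BirchSwinnertonDyer.Rank1Residual

namespace Summit.BirchSwinnertonDyer.Rank1Residual.Additive.GenusSeven

section Frame

variable {W : WeierstrassCurve ℚ} [W.IsElliptic] [W.IsGloballyMinimal] [Fact (Nat.Prime 7)]
  [ContinuousSMul ℤ_[7] (W.tateModule 7)] {K : ZpExtension ℚ 7} {hK : K.IsCyclotomic}
  {γ : Field.absoluteGaloisGroup ℚ} {I : IwasawaH1Data W 7 K γ}
  {F : GenusFrame} {θu : ∀ n : ℕ, globalUnitsOf (F.layer n)} {d : GenusDatum F θu}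

/-! ## §1 The (psiK) letter from Deuring generators -/

namespace PinnedKatoGenusFrame

variable (Φ : PinnedKatoGenusFrame W K hK I d)

/-- ★ **(psiK) for a pinned frame whose `ψ` has Deuring generators and ramification inside `(42)·𝔣`**: there are
integer-valued `b₀, b₁` on ideals with `2ψ(𝔟) = b₀(𝔟) + b₁(𝔟)·ιC(√−7)` for every admissible twist `𝔟` — the (psiK)
ARGUMENT of `KatoExpDatum.ofLaws`, VERBATIM (F-D1 `exists_coeffs_two_mul_heckeCharIdealValue_of_isTwist` with
`τ := ιC ∘ (Kcm → K̄cm)`, `μ := sqrtNegSeven`, `[Kcm : ℚ] = 2`).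
[cite: SilvermanATAEC1994, Ch. II Prop. 10.4 (proof, p. 170) and Cor. 10.4.1 (a) (p. 171)] [cite: Cox2013, §5.B (5.13)]
[cite: Kato2004Asterisque, §15.6 (p. 254) and §15.7 (pp. 255–256)] -/
theorem exists_psiCoords_of_generators
    (hvi : ∃ σ : Φ.Kcm →+* ℂ, ∀ w : HeightOneSpectrum (𝓞 Φ.Kcm), Φ.ψ.IsUnramifiedAt w →
      ∃ α : 𝓞 Φ.Kcm, Ideal.span {α} = w.asIdeal ∧ Φ.ψ.valueAtUniformizer w = σ α)
    (hram : ∀ w : HeightOneSpectrum (𝓞 Φ.Kcm), ¬ Φ.ψ.IsUnramifiedAt w → katoModulus6 7 Φ.𝔣 ≤ w.asIdeal) :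
    ∃ b₀ b₁ : Ideal (𝓞 Φ.Kcm) → ℤ, ∀ 𝔟 : Ideal (𝓞 Φ.Kcm), IsTwist 7 Φ.𝔣 𝔟 →
      2 * CM.heckeCharIdealValue Φ.ψ 𝔟 =
        (b₀ 𝔟 : ℂ) + (b₁ 𝔟 : ℂ) * Φ.ιC (algebraMap Φ.Kcm (AlgebraicClosure Φ.Kcm) Φ.sqrtNegSeven) :=
  exists_coeffs_two_mul_heckeCharIdealValue_of_isTwist Φ.finrank_Kcm Φ.sqrtNegSeven_sq
    (Φ.ιC.comp (algebraMap Φ.Kcm (AlgebraicClosure Φ.Kcm))) Φ.ψ hvi hram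

/-- The integer coordinate `b₀` of `2ψ` on admissible twists CHOSEN from `exists_psiCoords_of_generators`.
[cite: SilvermanATAEC1994, Ch. II Prop. 10.4 (proof, p. 170)] [cite: Kato2004Asterisque, §15.7 (pp. 255–256)] -/
def psiCoord₀
    (hvi : ∃ σ : Φ.Kcm →+* ℂ, ∀ w : HeightOneSpectrum (𝓞 Φ.Kcm), Φ.ψ.IsUnramifiedAt w →
      ∃ α : 𝓞 Φ.Kcm, Ideal.span {α} = w.asIdeal ∧ Φ.ψ.valueAtUniformizer w = σ α)
    (hram : ∀ w : HeightOneSpectrum (𝓞 Φ.Kcm), ¬ Φ.ψ.IsUnramifiedAt w → katoModulus6 7 Φ.𝔣 ≤ w.asIdeal) :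
    Ideal (𝓞 Φ.Kcm) → ℤ :=
  (Φ.exists_psiCoords_of_generators hvi hram).choose

/-- The integer coordinate `b₁` of `2ψ` on admissible twists CHOSEN from `exists_psiCoords_of_generators`.
[cite: SilvermanATAEC1994, Ch. II Prop. 10.4 (proof, p. 170)] [cite: Kato2004Asterisque, §15.7 (pp. 255–256)] -/
def psiCoord₁
    (hvi : ∃ σ : Φ.Kcm →+* ℂ, ∀ w : HeightOneSpectrum (𝓞 Φ.Kcm), Φ.ψ.IsUnramifiedAt w →
      ∃ α : 𝓞 Φ.Kcm, Ideal.span {α} = w.asIdeal ∧ Φ.ψ.valueAtUniformizer w = σ α)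
    (hram : ∀ w : HeightOneSpectrum (𝓞 Φ.Kcm), ¬ Φ.ψ.IsUnramifiedAt w → katoModulus6 7 Φ.𝔣 ≤ w.asIdeal) :
    Ideal (𝓞 Φ.Kcm) → ℤ :=
  (Φ.exists_psiCoords_of_generators hvi hram).choose_spec.choose

/-- The chosen coordinates satisfy the (psiK) letter. [cite: SilvermanATAEC1994, Ch. II Prop. 10.4 (proof, p. 170)]
[cite: Kato2004Asterisque, §15.7 (pp. 255–256)] -/
theorem two_mul_heckeCharIdealValue_eq_psiCoord
    (hvi : ∃ σ : Φ.Kcm →+* ℂ, ∀ w : HeightOneSpectrum (𝓞 Φ.Kcm), Φ.ψ.IsUnramifiedAt w →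
      ∃ α : 𝓞 Φ.Kcm, Ideal.span {α} = w.asIdeal ∧ Φ.ψ.valueAtUniformizer w = σ α)
    (hram : ∀ w : HeightOneSpectrum (𝓞 Φ.Kcm), ¬ Φ.ψ.IsUnramifiedAt w → katoModulus6 7 Φ.𝔣 ≤ w.asIdeal)
    (𝔟 : Ideal (𝓞 Φ.Kcm)) (h𝔟 : IsTwist 7 Φ.𝔣 𝔟) :
    2 * CM.heckeCharIdealValue Φ.ψ 𝔟 =
      (Φ.psiCoord₀ hvi hram 𝔟 : ℂ) + (Φ.psiCoord₁ hvi hram 𝔟 : ℂ) *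
        Φ.ιC (algebraMap Φ.Kcm (AlgebraicClosure Φ.Kcm) Φ.sqrtNegSeven) :=
  (Φ.exists_psiCoords_of_generators hvi hram).choose_spec.choose_spec 𝔟 h𝔟

end PinnedKatoGenusFrame

/-! ## §2 The constructor with (psiK) discharged -/

namespace KatoExpDatum

/-- ★ **`KatoExpDatum.ofLawsOfGenerators`** — `KatoExpDatum.ofLaws` with its (psiK) argument REPLACED by Deuring's clause (vi)
for `Φ.ψ` and the ramification support `(42)·𝔣`: the re-typed dual-exponential value datum of a pinned frame built from
`ι₇`, the (e2) `𝔏`-law `ExpStarCMShape`, and the (eZ) ★-value law alone (all other fields terms/theorems of this row,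
`bCoef₀/bCoef₁ := psiCoord₀/psiCoord₁`). [cite: Kato2004Asterisque, Prop. 15.9 (p. 258), Thm. 12.5 (1) (p. 221), 15.14 (p. 264), (15.16.1) (p. 265)]
[cite: SilvermanATAEC1994, Ch. II Prop. 10.4 (proof, p. 170) and Thm. 10.5 (b)] -/
def ofLawsOfGenerators (hγ : K.IsTopGenerator γ) (Φ : PinnedKatoGenusFrame W K hK I d) (ι₇ : ℚ_[7] →+* ℂ)
    (h2 : Φ.ExpStarCMShape)
    (e : ℕ) (α₀ α₁ : ℤ) (hα : α₀ ≠ 0 ∨ α₁ ≠ 0) (n₀ : ℕ)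
    (hZ : ∀ (n : ℕ), n₀ ≤ n → ∀ (χ : absoluteGaloisGroup Φ.Kcm →ₜ* ℂˣ),
      (∀ σ ∈ Φ.towerK.layerSubgroup (n + 1), χ σ = 1) →
      IsPrimitiveRoot (((χ Φ.γK : ℂˣ)) : ℂ) (7 ^ (n + 1)) →
      ∀ Lf : ℂ → ℂ, CM.IsDepletedHeckeL Φ.ψ χ (7 * (7 * F.d)) Lf →
        (7 : ℂ) ^ e * Φ.valOf ι₇ χ (I.resOver Φ.IK hγ Φ.isTopGenerator_γK Φ.zOne) =
          ((α₀ : ℂ) + (α₁ : ℂ) * Φ.ιC (algebraMap Φ.Kcm (AlgebraicClosure Φ.Kcm) Φ.sqrtNegSeven)) * Φ.Ω⁻¹ * Lf 1)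
    (hvi : ∃ σ : Φ.Kcm →+* ℂ, ∀ w : HeightOneSpectrum (𝓞 Φ.Kcm), Φ.ψ.IsUnramifiedAt w →
      ∃ α : 𝓞 Φ.Kcm, Ideal.span {α} = w.asIdeal ∧ Φ.ψ.valueAtUniformizer w = σ α)
    (hram : ∀ w : HeightOneSpectrum (𝓞 Φ.Kcm), ¬ Φ.ψ.IsUnramifiedAt w → katoModulus6 7 Φ.𝔣 ≤ w.asIdeal) :
    KatoExpDatum hγ Φ :=
  ofLaws hγ Φ ι₇ h2 e α₀ α₁ hα n₀ hZ (Φ.psiCoord₀ hvi hram) (Φ.psiCoord₁ hvi hram)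
    (fun 𝔟 h𝔟 => Φ.two_mul_heckeCharIdealValue_eq_psiCoord hvi hram 𝔟 h𝔟)

variable {hγ : K.IsTopGenerator γ} {Φ : PinnedKatoGenusFrame W K hK I d} {ι₇ : ℚ_[7] →+* ℂ}
  {h2 : Φ.ExpStarCMShape} {e : ℕ} {α₀ α₁ : ℤ} {hα : α₀ ≠ 0 ∨ α₁ ≠ 0} {n₀ : ℕ}
  {hZ : ∀ (n : ℕ), n₀ ≤ n → ∀ (χ : absoluteGaloisGroup Φ.Kcm →ₜ* ℂˣ),
      (∀ σ ∈ Φ.towerK.layerSubgroup (n + 1), χ σ = 1) →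
      IsPrimitiveRoot (((χ Φ.γK : ℂˣ)) : ℂ) (7 ^ (n + 1)) →
      ∀ Lf : ℂ → ℂ, CM.IsDepletedHeckeL Φ.ψ χ (7 * (7 * F.d)) Lf →
        (7 : ℂ) ^ e * Φ.valOf ι₇ χ (I.resOver Φ.IK hγ Φ.isTopGenerator_γK Φ.zOne) =
          ((α₀ : ℂ) + (α₁ : ℂ) * Φ.ιC (algebraMap Φ.Kcm (AlgebraicClosure Φ.Kcm) Φ.sqrtNegSeven)) * Φ.Ω⁻¹ * Lf 1}
  {hvi : ∃ σ : Φ.Kcm →+* ℂ, ∀ w : HeightOneSpectrum (𝓞 Φ.Kcm), Φ.ψ.IsUnramifiedAt w →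
      ∃ α : 𝓞 Φ.Kcm, Ideal.span {α} = w.asIdeal ∧ Φ.ψ.valueAtUniformizer w = σ α}
  {hram : ∀ w : HeightOneSpectrum (𝓞 Φ.Kcm), ¬ Φ.ψ.IsUnramifiedAt w → katoModulus6 7 Φ.𝔣 ≤ w.asIdeal}

/-- Projection: `ι₇`. [cite: Kato2004Asterisque, Thm. 12.5 (1) (p. 221)] -/
@[simp] theorem ofLawsOfGenerators_ι₇ : (ofLawsOfGenerators hγ Φ ι₇ h2 e α₀ α₁ hα n₀ hZ hvi hram).ι₇ = ι₇ := rfl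

/-- Projection: `val = valOf Φ ι₇`. [cite: Kato2004Asterisque, Prop. 15.9 (p. 258)] -/
@[simp] theorem ofLawsOfGenerators_val : (ofLawsOfGenerators hγ Φ ι₇ h2 e α₀ α₁ hα n₀ hZ hvi hram).val = Φ.valOf ι₇ :=
  rfl

/-- Projection: `uStar = 1`. [cite: Kato2004Asterisque, Thm. 12.5 (1) (p. 221)] -/
@[simp] theorem ofLawsOfGenerators_uStar : (ofLawsOfGenerators hγ Φ ι₇ h2 e α₀ α₁ hα n₀ hZ hvi hram).uStar = 1 := rfl

/-- Projection: `zStar = res zOne`. [cite: Kato2004Asterisque, Thm. 12.5 (1) (p. 221) and 15.14 (p. 264)] -/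
@[simp] theorem ofLawsOfGenerators_zStar :
    (ofLawsOfGenerators hγ Φ ι₇ h2 e α₀ α₁ hα n₀ hZ hvi hram).zStar = I.resOver Φ.IK hγ Φ.isTopGenerator_γK Φ.zOne :=
  rfl

/-- Projection: `e`. [cite: Kato2004Asterisque, (15.16.1) (p. 265)] -/
@[simp] theorem ofLawsOfGenerators_e : (ofLawsOfGenerators hγ Φ ι₇ h2 e α₀ α₁ hα n₀ hZ hvi hram).e = e := rfl

/-- Projection: `α₀`. [cite: Kato2004Asterisque, (15.16.1) (p. 265)] -/
@[simp] theorem ofLawsOfGenerators_α₀ : (ofLawsOfGenerators hγ Φ ι₇ h2 e α₀ α₁ hα n₀ hZ hvi hram).α₀ = α₀ := rfl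

/-- Projection: `α₁`. [cite: Kato2004Asterisque, (15.16.1) (p. 265)] -/
@[simp] theorem ofLawsOfGenerators_α₁ : (ofLawsOfGenerators hγ Φ ι₇ h2 e α₀ α₁ hα n₀ hZ hvi hram).α₁ = α₁ := rfl

/-- Projection: `n₀`. [cite: Kato2004Asterisque, Thm. 12.5 (1) (p. 221)] -/
@[simp] theorem ofLawsOfGenerators_n₀ : (ofLawsOfGenerators hγ Φ ι₇ h2 e α₀ α₁ hα n₀ hZ hvi hram).n₀ = n₀ := rfl

/-- Projection: `bCoef₀ = psiCoord₀`. [cite: Kato2004Asterisque, §15.7 (p. 256)] -/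
@[simp] theorem ofLawsOfGenerators_bCoef₀ :
    (ofLawsOfGenerators hγ Φ ι₇ h2 e α₀ α₁ hα n₀ hZ hvi hram).bCoef₀ = Φ.psiCoord₀ hvi hram := rfl

/-- Projection: `bCoef₁ = psiCoord₁`. [cite: Kato2004Asterisque, §15.7 (p. 256)] -/
@[simp] theorem ofLawsOfGenerators_bCoef₁ :
    (ofLawsOfGenerators hγ Φ ι₇ h2 e α₀ α₁ hα n₀ hZ hvi hram).bCoef₁ = Φ.psiCoord₁ hvi hram := rfl

/-- Projection: `artExp = artinExponent` of the cyclotomic `ℤ₇`-tower of `Kcm`. [cite: Kato2004Asterisque, (15.12.2) (p. 263)] -/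
@[simp] theorem ofLawsOfGenerators_artExp :
    (ofLawsOfGenerators hγ Φ ι₇ h2 e α₀ α₁ hα n₀ hZ hvi hram).artExp = ZpExtension.artinExponent Φ.towerK := rfl

/-- The normalised norm `N(α)` of the constructed datum. [cite: Kato2004Asterisque, (15.16.1) (p. 265)] -/
theorem ofLawsOfGenerators_normA :
    (ofLawsOfGenerators hγ Φ ι₇ h2 e α₀ α₁ hα n₀ hZ hvi hram).normA = (α₀ ^ 2 + 7 * α₁ ^ 2).toNat := rfl

end KatoExpDatum

/-- ★ **`KatoExpCompatShape hγ Φ` FROM (e2) AND (eZ) ALONE for a frame on the Deuring character** (clause (vi) and the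
ramification support `(42)·𝔣` in hand): the (r3) binder of block (R) holds as soon as the (e2) `𝔏`-law and the (eZ)
★-value law for the reading `valOf` are supplied. [cite: Kato2004Asterisque, Prop. 15.9 (p. 258), Thm. 12.5 (1) (p. 221), 15.14 (p. 264)]
[cite: SilvermanATAEC1994, Ch. II Prop. 10.4 (proof, p. 170) and Thm. 10.5 (b)] -/
theorem katoExpCompatShape_of_laws_of_generators (hγ : K.IsTopGenerator γ) (Φ : PinnedKatoGenusFrame W K hK I d)
    (ι₇ : ℚ_[7] →+* ℂ) (h2 : Φ.ExpStarCMShape)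
    (e : ℕ) (α₀ α₁ : ℤ) (hα : α₀ ≠ 0 ∨ α₁ ≠ 0) (n₀ : ℕ)
    (hZ : ∀ (n : ℕ), n₀ ≤ n → ∀ (χ : absoluteGaloisGroup Φ.Kcm →ₜ* ℂˣ),
      (∀ σ ∈ Φ.towerK.layerSubgroup (n + 1), χ σ = 1) →
      IsPrimitiveRoot (((χ Φ.γK : ℂˣ)) : ℂ) (7 ^ (n + 1)) →
      ∀ Lf : ℂ → ℂ, CM.IsDepletedHeckeL Φ.ψ χ (7 * (7 * F.d)) Lf →
        (7 : ℂ) ^ e * Φ.valOf ι₇ χ (I.resOver Φ.IK hγ Φ.isTopGenerator_γK Φ.zOne) =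
          ((α₀ : ℂ) + (α₁ : ℂ) * Φ.ιC (algebraMap Φ.Kcm (AlgebraicClosure Φ.Kcm) Φ.sqrtNegSeven)) * Φ.Ω⁻¹ * Lf 1)
    (hvi : ∃ σ : Φ.Kcm →+* ℂ, ∀ w : HeightOneSpectrum (𝓞 Φ.Kcm), Φ.ψ.IsUnramifiedAt w →
      ∃ α : 𝓞 Φ.Kcm, Ideal.span {α} = w.asIdeal ∧ Φ.ψ.valueAtUniformizer w = σ α)
    (hram : ∀ w : HeightOneSpectrum (𝓞 Φ.Kcm), ¬ Φ.ψ.IsUnramifiedAt w → katoModulus6 7 Φ.𝔣 ≤ w.asIdeal) :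
    KatoExpCompatShape hγ Φ :=
  ⟨KatoExpDatum.ofLawsOfGenerators hγ Φ ι₇ h2 e α₀ α₁ hα n₀ hZ hvi hram⟩

/-- **Existence form without `ι₇`**: `ι₇` can always be supplied (`nonempty_padicRingHom_complex`), so for a frame on the
Deuring character `KatoExpCompatShape hγ Φ` follows from an (e2) `𝔏`-law and an (eZ) ★-value law for SOME complex reading of
`ℚ₇` — stated with the reading universally quantified in (eZ) so that no choice is visible to the caller.
[cite: Kato2004Asterisque, Prop. 15.9 (p. 258), Thm. 12.5 (1) (p. 221), 15.14 (p. 264)] -/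
theorem katoExpCompatShape_of_laws_of_generators' (hγ : K.IsTopGenerator γ) (Φ : PinnedKatoGenusFrame W K hK I d)
    (h2 : Φ.ExpStarCMShape)
    (hZ : ∀ ι₇ : ℚ_[7] →+* ℂ, ∃ (e : ℕ) (α₀ α₁ : ℤ) (_ : α₀ ≠ 0 ∨ α₁ ≠ 0) (n₀ : ℕ),
      ∀ (n : ℕ), n₀ ≤ n → ∀ (χ : absoluteGaloisGroup Φ.Kcm →ₜ* ℂˣ),
      (∀ σ ∈ Φ.towerK.layerSubgroup (n + 1), χ σ = 1) →
      IsPrimitiveRoot (((χ Φ.γK : ℂˣ)) : ℂ) (7 ^ (n + 1)) →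
      ∀ Lf : ℂ → ℂ, CM.IsDepletedHeckeL Φ.ψ χ (7 * (7 * F.d)) Lf →
        (7 : ℂ) ^ e * Φ.valOf ι₇ χ (I.resOver Φ.IK hγ Φ.isTopGenerator_γK Φ.zOne) =
          ((α₀ : ℂ) + (α₁ : ℂ) * Φ.ιC (algebraMap Φ.Kcm (AlgebraicClosure Φ.Kcm) Φ.sqrtNegSeven)) * Φ.Ω⁻¹ * Lf 1)
    (hvi : ∃ σ : Φ.Kcm →+* ℂ, ∀ w : HeightOneSpectrum (𝓞 Φ.Kcm), Φ.ψ.IsUnramifiedAt w →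
      ∃ α : 𝓞 Φ.Kcm, Ideal.span {α} = w.asIdeal ∧ Φ.ψ.valueAtUniformizer w = σ α)
    (hram : ∀ w : HeightOneSpectrum (𝓞 Φ.Kcm), ¬ Φ.ψ.IsUnramifiedAt w → katoModulus6 7 Φ.𝔣 ≤ w.asIdeal) :
    KatoExpCompatShape hγ Φ := by
  obtain ⟨ι₇⟩ := nonempty_padicRingHom_complex
  obtain ⟨e, α₀, α₁, hα, n₀, h⟩ := hZ ι₇
  exact katoExpCompatShape_of_laws_of_generators hγ Φ ι₇ h2 e α₀ α₁ hα n₀ h hvi hram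

end Frame

end Summit.BirchSwinnertonDyer.Rank1Residual.Additive.GenusSeven

end
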